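import Literature.AlgebraicGeometry.HodgeTheory.GAGADimensionCharts
import HarnessLib

/-!
# GAGA dimension comparison — a simple point is a regular point of the algebraic codimension

Fourth proof file for the named fact
`Literature.AlgebraicGeometry.HodgeTheory.gaga_le_coheight_of_regularLocus_codim`
(`HodgeTheory/GAGADimension.lean`; Serre, *GAGA* §6 Prop. 3 Cor. 2–3, p. 11), continuing
`GAGADimensionCharts.lean` (notation `d s = fderiv ℂ (s ∘ e⁻¹) (e Q₀)`, `𝔪 = ker (evaluation at
Q₀) ⊂ Γ(X, U)`):

* `surjective_pi_fderiv_chart` — if `g₁, …, g_c ∈ 𝔪` are linearly independent modulo `𝔪²` over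
  `ℂ`, then `v ↦ (dg₁ v, …, dg_c v) : ℂⁿ → ℂᶜ` is onto (a linear form vanishing on the range gives a
  relation `∑ μⱼ dgⱼ = 0`, so `∑ μⱼ gⱼ ∈ 𝔪²` by `mem_sq_of_fderiv_chart_eq_zero`, so `μ = 0`);
* `isRegularPointOfCodim_of_simplePoint` — if moreover the `gⱼ` cut out the Zariski-closed `Z`
  on a basic open `D(h) ∋ Q₀` and regular functions on `U` are holomorphic on `U(ℂ)`, then `Q₀` is a
  regular point of codimension `c` (`Literature.Geometry.Kaehler.IsRegularPointOfCodim`) of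
  `Z(ℂ) ⊆ X(ℂ)` for the algebraic-chart atlas: `Z(ℂ) ∩ D(h)(ℂ) = {g = 0}` and the manifold
  derivative of `g` at `Q₀` is onto (`Literature.Geometry.Kaehler.surjective_mfderiv_iff_extChartAt`).

This is Serre's statement that at a simple point of `Z` the analytic space `Z^h` is a submanifold
of `X^h` of the algebraic dimension (GAGA §1 n°4, §2 n°6 Cor. 2–3); the choice of the simple point
is `GAGADimension.exists_simplePointData`, and the assembly is `GAGADimensionProofs.lean`.

## References

* J.-P. Serre, *Géométrie algébrique et géométrie analytique*, Ann. Inst. Fourier **6** (1956),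
  §1 n°4, §2 n°6 Prop. 3 Cor. 2–3 (p. 11). [SerreGAGA1956]
* E. M. Chirka, *Complex Analytic Sets* (1989), §2.3 (regular points). [Chirka1989]
-/

noncomputable section

open scoped Manifold ContDiff Topology
open CategoryTheory AlgebraicGeometry Filter
open Literature.AlgebraicGeometry.Motives
open Literature.AlgebraicGeometry.Motives.AlgPoints (evalOrZero evalOrZero_of_mem evalOrZero_of_not_mem)

namespace Literature.AlgebraicGeometry.HodgeTheory

namespace GAGADimension

variable {X : SchemeOver ℂ} {n : ℕ}

section Chart

variable (e : OpenPartialHomeomorph (ComplexPoints X) (Fin n → ℂ)) {Q₀ : ComplexPoints X}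
  (hQ₀ : Q₀ ∈ e.source)
  (hol : ∀ (U : X.left.affineOpens) (s : Γ(X.left, ↑U)),
    ContDiffOn ℂ ω (evalOrZero ↑U s ∘ e.symm)
      (e.target ∩ e.symm ⁻¹' {Q | Q.pt ∈ (↑U : X.left.Opens)}))

include hQ₀ hol in
/-- **Independent differentials.** If `g₁, …, g_c ∈ 𝔪` are linearly independent modulo `𝔪²`
over `ℂ` (and local coordinates `tᵢ` exist as in `linearIndependent_fderiv_chart`), then the map
`v ↦ (dg₁ v, …, dg_c v) : ℂⁿ → ℂᶜ` is onto. [cite: SerreGAGA1956, §2 n°6 Cor. 2 with §1 n°4] -/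
theorem surjective_pi_fderiv_chart (U : X.left.affineOpens)
    (hU : Q₀.pt ∈ (↑U : X.left.Opens)) (t : Fin n → Γ(X.left, ↑U))
    (htspan : ∀ a ∈ RingHom.ker (Q₀.evalRingHom ↑U hU), ∃ coef : Fin n → ℂ,
      a - ∑ i, SchemeOver.scalarRingHom X ↑U (coef i) * t i ∈
        RingHom.ker (Q₀.evalRingHom ↑U hU) ^ 2)
    (alg : ∃ (U₁ : X.left.affineOpens) (x : Fin n → Γ(X.left, ↑U₁)),
      e.source ⊆ {Q | Q.pt ∈ (↑U₁ : X.left.Opens)} ∧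
        ∀ Q ∈ e.source, ∀ i, e Q i = evalOrZero ↑U₁ (x i) Q)
    {c : ℕ} (g : Fin c → Γ(X.left, ↑U)) (hg : ∀ j, g j ∈ RingHom.ker (Q₀.evalRingHom ↑U hU))
    (hindep : ∀ coef : Fin c → ℂ,
      ∑ j, SchemeOver.scalarRingHom X ↑U (coef j) * g j ∈ RingHom.ker (Q₀.evalRingHom ↑U hU) ^ 2 →
        coef = 0) :
    Function.Surjective
      (ContinuousLinearMap.pi fun j => fderiv ℂ (evalOrZero ↑U (g j) ∘ e.symm) (e Q₀)) := by
  set L := ContinuousLinearMap.pi fun j => fderiv ℂ (evalOrZero ↑U (g j) ∘ e.symm) (e Q₀) with hL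
  by_contra hsurj
  have hlt : LinearMap.range (L : (Fin n → ℂ) →ₗ[ℂ] (Fin c → ℂ)) < ⊤ := by
    refine lt_top_iff_ne_top.2 fun htop => hsurj ?_
    exact LinearMap.range_eq_top.1 htop
  obtain ⟨μ, hμ0, hμ⟩ := Submodule.exists_le_ker_of_lt_top _ hlt
  -- `μ ∘ L = 0`, i.e. `∑ μⱼ dgⱼ = 0`
  have hzero : fderiv ℂ (evalOrZero ↑U
      (∑ j, SchemeOver.scalarRingHom X ↑U (μ (Pi.single j 1)) * g j) ∘ e.symm) (e Q₀) = 0 := by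
    rw [fderiv_chart_sum e hQ₀ hol U hU]
    simp only [fderiv_chart_smul e hQ₀ hol U hU]
    refine ContinuousLinearMap.ext fun v => ?_
    have hv : μ (L v) = 0 := by
      have : L v ∈ LinearMap.ker μ := hμ ⟨v, rfl⟩
      simpa using this
    rw [dual_apply_eq_sum μ (L v)] at hv
    simp only [hL, ContinuousLinearMap.pi_apply] at hv
    simpa [mul_comm] using hv
  have hmem : ∑ j, SchemeOver.scalarRingHom X ↑U (μ (Pi.single j 1)) * g j ∈
      RingHom.ker (Q₀.evalRingHom ↑U hU) :=
    Ideal.sum_mem _ fun j _ => Ideal.mul_mem_left _ _ (hg j)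
  have hsq := mem_sq_of_fderiv_chart_eq_zero e hQ₀ hol U hU t htspan alg hmem hzero
  have hμj : ∀ j, μ (Pi.single j 1) = 0 := fun j => congrFun (hindep _ hsq) j
  apply hμ0
  refine LinearMap.ext fun w => ?_
  rw [dual_apply_eq_sum μ w]
  simp [hμj]

end Chart

/-! ### The regular point -/

section RegularPoint

variable [ChartedSpace (Fin n → ℂ) (ComplexPoints X)]
  [IsManifold 𝓘(ℂ, Fin n → ℂ) 1 (ComplexPoints X)]

/-- **A simple point of `Z` is a regular point of `Z(ℂ)` of the algebraic codimension.** Let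
`X(ℂ)` carry a holomorphic atlas whose chart `e` at `Q₀` has regular coordinates and reads all
regular functions holomorphically; let `U ∋ Q₀` be an affine open with local coordinates
`t₁, …, tₙ` modulo `𝔪²` at `Q₀`, and let `g₁, …, g_c ∈ Γ(X, U)` vanish at `Q₀`, be linearly
independent modulo `𝔪²`, and cut out the Zariski-closed `Z` on the basic open `D(h) ∋ Q₀`. If the
regular functions on `U` are holomorphic on `U(ℂ)`, then `Q₀` is a regular point of codimension
`c` of `Z(ℂ) ⊆ X(ℂ)`: near `Q₀`, `Z(ℂ) = {g₁ = ⋯ = g_c = 0}` with `(dg₁, …, dg_c)` onto.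
[cite: SerreGAGA1956, §2 n°6 Cor. 2–3 with §1 n°4] -/
theorem isRegularPointOfCodim_of_simplePoint
    (e : OpenPartialHomeomorph (ComplexPoints X) (Fin n → ℂ)) {Q₀ : ComplexPoints X}
    (he : chartAt (Fin n → ℂ) Q₀ = e) (hQ₀ : Q₀ ∈ e.source)
    (hol : ∀ (U : X.left.affineOpens) (s : Γ(X.left, ↑U)),
      ContDiffOn ℂ ω (evalOrZero ↑U s ∘ e.symm)
        (e.target ∩ e.symm ⁻¹' {Q | Q.pt ∈ (↑U : X.left.Opens)}))
    (alg : ∃ (U₁ : X.left.affineOpens) (x : Fin n → Γ(X.left, ↑U₁)),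
      e.source ⊆ {Q | Q.pt ∈ (↑U₁ : X.left.Opens)} ∧
        ∀ Q ∈ e.source, ∀ i, e Q i = evalOrZero ↑U₁ (x i) Q)
    (U : X.left.affineOpens) (hU : Q₀.pt ∈ (↑U : X.left.Opens))
    (hmd : ∀ s : Γ(X.left, ↑U), MDifferentiableOn 𝓘(ℂ, Fin n → ℂ) 𝓘(ℂ, ℂ) (evalOrZero ↑U s)
      {Q : ComplexPoints X | Q.pt ∈ (↑U : X.left.Opens)})
    (t : Fin n → Γ(X.left, ↑U))
    (htspan : ∀ a ∈ RingHom.ker (Q₀.evalRingHom ↑U hU), ∃ coef : Fin n → ℂ,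
      a - ∑ i, SchemeOver.scalarRingHom X ↑U (coef i) * t i ∈
        RingHom.ker (Q₀.evalRingHom ↑U hU) ^ 2)
    {c : ℕ} (g : Fin c → Γ(X.left, ↑U)) (hg : ∀ j, g j ∈ RingHom.ker (Q₀.evalRingHom ↑U hU))
    (hindep : ∀ coef : Fin c → ℂ,
      ∑ j, SchemeOver.scalarRingHom X ↑U (coef j) * g j ∈ RingHom.ker (Q₀.evalRingHom ↑U hU) ^ 2 →
        coef = 0)
    (h : Γ(X.left, ↑U)) (hh : Q₀.pt ∈ X.left.basicOpen h) (Z : Set X.left)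
    (hZ : ∀ Q : ComplexPoints X, ∀ hQ : Q.pt ∈ X.left.basicOpen h,
      Q.pt ∈ Z ↔ ∀ j, Q.eval ↑U (X.left.basicOpen_le h hQ) (g j) = 0) :
    Literature.Geometry.Kaehler.IsRegularPointOfCodim 𝓘(ℂ, Fin n → ℂ)
      {Q : ComplexPoints X | Q.pt ∈ Z} c Q₀ := by
  set W : Set (ComplexPoints X) := {Q | Q.pt ∈ X.left.basicOpen h} with hW
  set f : ComplexPoints X → Fin c → ℂ := fun Q j => evalOrZero ↑U (g j) Q with hf
  refine ⟨W, AlgPoints.isOpen_setOf_pt_mem _, hh, f, ?_, ?_, ?_⟩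
  · -- holomorphy on `W ⊆ U(ℂ)`
    refine (Literature.Geometry.Kaehler.mdifferentiableOn_pi_space.2 fun j => hmd (g j)).mono ?_
    intro Q hQ
    exact X.left.basicOpen_le h hQ
  · -- the zero set
    ext Q
    constructor
    · rintro ⟨hQZ, hQW⟩
      refine ⟨hQW, ?_⟩
      change f Q = 0
      funext j
      simp only [hf, evalOrZero_of_mem _ (X.left.basicOpen_le h hQW), Pi.zero_apply]
      exact (hZ Q hQW).1 hQZ j
    · rintro ⟨hQW, hfQ⟩
      refine ⟨(hZ Q hQW).2 fun j => ?_, hQW⟩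
      have := congrFun (hfQ : f Q = 0) j
      simpa only [hf, evalOrZero_of_mem _ (X.left.basicOpen_le h hQW), Pi.zero_apply] using this
  · -- the differential is onto
    have hy : Q₀ ∈ (extChartAt 𝓘(ℂ, Fin n → ℂ) Q₀).source := by
      rw [extChartAt_source, he]
      exact hQ₀
    have hcomp : f ∘ (extChartAt 𝓘(ℂ, Fin n → ℂ) Q₀).symm =
        fun w j => (evalOrZero ↑U (g j) ∘ e.symm) w := by
      funext w j
      simp [hf, he]
    have hpt : extChartAt 𝓘(ℂ, Fin n → ℂ) Q₀ Q₀ = e Q₀ := by simp [he]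
    have hdiff : ∀ j, DifferentiableAt ℂ (evalOrZero ↑U (g j) ∘ e.symm) (e Q₀) := fun j =>
      differentiableAt_chart e hQ₀ hol U hU (g j)
    have hF : DifferentiableAt ℂ (f ∘ (extChartAt 𝓘(ℂ, Fin n → ℂ) Q₀).symm)
        (extChartAt 𝓘(ℂ, Fin n → ℂ) Q₀ Q₀) := by
      rw [hcomp, hpt]
      exact differentiableAt_pi.2 hdiff
    refine (Literature.Geometry.Kaehler.surjective_mfderiv_iff_extChartAt hy hF).2 ?_
    rw [hcomp, hpt, fderiv_pi hdiff]
    exact surjective_pi_fderiv_chart e hQ₀ hol U hU t htspan alg g hg hindep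

end RegularPoint

end GAGADimension

end Literature.AlgebraicGeometry.HodgeTheory
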